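import Summits.QuantumFields.BalabanUV.Beta.FP.GhostMixQuarticTwoLeg
import Summits.QuantumFields.BalabanUV.Beta.FP.BondFamilyCovariance

/-!
# `Beta/FP/GhostMixPieceQuartic` — road «FP» (binder row D1), row KER-γ (α2) sub-row **α2-c** «GHOST», PART 2b(i): THE (MIX-4) GHOST PIECE OF THE JUNCTION — the
# windowed `(c, e)`-table of the quartic word (ONE second-order jet carrying the `c`-bond at `s` and the `e`-bond at `s′` on one averaging path, inner leg back
# to the root block) as a DATA def, its joint `N`-block periodicity under DISPLAYED covariance letters, its majorant, entry bound and LEDGER LINE by name over F′'s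
# `FineSplitJunctionMajorant.rem_of_majorant` (p253277) — the `hLgh` member for this piece

HONEST DEPENDENCY (page 1, mandatory): continuum YM on T⁴ ⇐ BetaPertH ∧ nine spine estimates (0/9 proved); BetaPertH ⇐ (D1) ∧ (D4) ∧
CAP+tail; G-an2-4 gates asym, D1 and NE2/3/4.  HONEST FRAMING (cell contract, verbatim): «discharging `BetaPertH` makes Bałaban's UV
stability UNCONDITIONAL — a real constructive-QFT result; it is NOT the continuum limit and NOT the Clay problem.»  THIS MODULE is [our object] bookkeeping (one
data def over ABSTRACT constituents — bond-letter 0-form family `(p, rad)`, coarse windows `U`, offsets `W`, inner leg `I` — every road letter DISPLAYED: (radCov),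
(Ucov), (Icov), the inner leg's SUP letter (I₀), the pair-mass sup letter (Psup), the junction's (Kcov)(col)(J)(J′)) and [folklore] plumbing BY NAME over
`MixLoopPowerCountingMassQuartic.abs_mix4_le_mass`, `GhostMixQuarticTwoLeg.windowedPairMass_bond_le` (p253915) and F′.  It asserts nothing about Bałaban's
constrained objects, cites nothing, mints no `Prop` fact, 0 sorry.  NOT (H2), NOT (LEDGER-gh)'s numbers, NOT hsplit, NOT D1, NOT BetaPertH, NOT continuum, NOT Clay.

ABSOLUTE RULE (cell charter, verbatim): «No internally-minted statement may enter as a cited fact. Every hypothesis is either kernel-proved in this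
package or a verbatim quotation of a PUBLISHED theorem with page reference. The manuscript(s) under audit are NOT citable for their own disputed
steps — they are the thing under adjudication; programme-internal (2001/route/tribunal) claims are never citable.»

CONTENT: §1 [our object] **`gmix4Piece`** + `gmix4Piece_apply`; §2 [folklore] **`isBlockPeriodic_gmix4Piece`** (`BondFamilyCovariance.ker₂_bond_shift` BY NAME); §3 [folklore] **`kappa_gmix4Piece`** (majorant), **`bounded_gmix4Piece`**; §4 [folklore] **`ledger_gmix4Piece`**.
Provenance: D1 formalisation swarm LEAF PROVER 05, unit `b2b-balaban-beta-d1-formalise-leaf-05` gen 15, 2026-08-21, road FP row KER-γ (α2) sub-row α2-c (owner GO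
R-FP-35 (a), words l.28227 «PART 2 THIS SHAPE», l.28436, l.28614; R-FP-36 (b)); «not in print; our bookkeeping»; no existing file touched.
-/

noncomputable section

namespace Summit.QuantumFields.BalabanUV.Beta.FP.GhostMixPieceQuartic

open Finset Real
open scoped BigOperators
open Literature.MathematicalPhysics.QuantumFieldTheory.Balaban1983to89
open Literature.MathematicalPhysics.QuantumFieldTheory.Balaban1983to89.Beta
open ExpKernelCalculus (Site MKer shiftK)
open OneStepResolventKernel (Fib)
open OneStepKernelFamily (colH)
open DyadicShell (Pt supNorm)
open AxialBlockWeights (fineBlock)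
open Summit.QuantumFields.BalabanUV.Beta.D1BFx.MomentTransferPeriodic (IsBlockPeriodic)
open Summit.QuantumFields.BalabanUV.Beta.D1BFx.MomentTransferPeriodicEntry (EKer₂ dressedEntryP)
open Summit.QuantumFields.BalabanUV.Beta.FP.TransportInfinityM (colOf)
open Summit.QuantumFields.BalabanUV.Beta.FP.AveragingJetLettersRootedSecond (ker₂)
open Summit.QuantumFields.BalabanUV.Beta.FP.ScalarAveragingJetLetters (sclW sclFld sclBg)
open Summit.QuantumFields.BalabanUV.Beta.FP.MixLoopPowerCountingMassQuartic (abs_mix4_le_mass)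
open Summit.QuantumFields.BalabanUV.Beta.FP.GhostMixQuarticTwoLeg (windowedPairMass_bond_le)
open Summit.QuantumFields.BalabanUV.Beta.FP.FineSplitJunctionMajorant (rem_of_majorant)
open Summit.QuantumFields.BalabanUV.Beta.FP.BondFamilyCovariance (ker₂_bond_shift)

variable {σ : Type*} [Fintype σ]

/-! ## §1 The windowed (MIX-4) ghost piece -/

/-- [our object] **THE WINDOWED (MIX-4) GHOST PIECE** of the junction's near table: the `(c, e)` entry at `(s, s′)` is the quartic word — ONE second-order jet of the
bond-letter 0-form family `(p, rad)` at blocking `N` carrying the `c`-bond at `s` (outer letter) and the `e`-bond at `s′` (inner letter), times the inner leg `I`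
from the jet's field point `s + w` back to the root block — summed over the coarse window `U s` and the offset window `W`, CUT OFF at `‖s′ − s‖∞ ≤ Nw`. -/
def gmix4Piece (N : ℕ) (p : σ → ℝ) (rad : σ → Pt → Pt → List (Pt × Fin 4)) (U : Pt → Finset Pt) (W : Finset Pt)
    (I : Pt → Pt → ℝ) (Nw : ℕ) : EKer₂ 4 :=
  fun c e s s' => if supNorm (s' - s) ≤ Nw then
    ∑ u ∈ U s, ∑ w ∈ W, ker₂ (sclW N p) (sclFld N u) (sclBg N u rad) (s, c) (s', e) (s + w) * I (s + w) u else 0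

/-- [our object] the piece, unfolded. -/
theorem gmix4Piece_apply (N : ℕ) (p : σ → ℝ) (rad : σ → Pt → Pt → List (Pt × Fin 4)) (U : Pt → Finset Pt) (W : Finset Pt)
    (I : Pt → Pt → ℝ) (Nw : ℕ) (c e : Fin 4) (s s' : Pt) :
    gmix4Piece N p rad U W I Nw c e s s' = if supNorm (s' - s) ≤ Nw then
      ∑ u ∈ U s, ∑ w ∈ W, ker₂ (sclW N p) (sclFld N u) (sclBg N u rad) (s, c) (s', e) (s + w) * I (s + w) u else 0 := rfl

/-! ## §2 Block covariance of the second-jet kernel and the joint block periodicity of the piece -/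

section Periodicity

variable {N : ℕ} {p : σ → ℝ} {rad : σ → Pt → Pt → List (Pt × Fin 4)}

/-- [folklore] **THE (MIX-4) GHOST PIECE IS JOINTLY `N`-BLOCK PERIODIC** (F′'s `hGper`) under (radCov), (Ucov) `U (b + N•t) = (U b) + t`, (Icov) `I (x + N•t) (u + t) = I x u`. -/
theorem isBlockPeriodic_gmix4Piece
    (hradCov : ∀ (s : σ) (u t x' : Pt), rad s (u + t) x' = (rad s u x').map (fun ℓ => (ℓ.1 + (N : ℤ) • t, ℓ.2)))
    {U : Pt → Finset Pt} (hUcov : ∀ b t : Pt, U (b + (N : ℤ) • t) = (U b).image (· + t))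
    {I : Pt → Pt → ℝ} (hIcov : ∀ x u t : Pt, I (x + (N : ℤ) • t) (u + t) = I x u)
    (W : Finset Pt) (Nw : ℕ) (c e : Fin 4) :
    IsBlockPeriodic N (gmix4Piece N p rad U W I Nw c e) := by
  classical
  intro t s s'
  simp only [gmix4Piece_apply]
  have ew : supNorm (s' + (N : ℤ) • t - (s + (N : ℤ) • t)) = supNorm (s' - s) := by rw [add_sub_add_right_eq_sub]
  rw [ew, hUcov s t, Finset.sum_image fun x _ y _ h => add_left_injective t h]
  refine if_congr Iff.rfl (Finset.sum_congr rfl fun u _ => Finset.sum_congr rfl fun w _ => ?_) rfl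
  have e1 : s + (N : ℤ) • t + w = s + w + (N : ℤ) • t := add_right_comm _ _ _
  rw [e1, ker₂_bond_shift hradCov, hIcov]

end Periodicity

/-! ## §3 The majorant and the entry bound -/

section Shape

variable {N : ℕ} {p : σ → ℝ} {rad : σ → Pt → Pt → List (Pt × Fin 4)} {U : Pt → Finset Pt} {W : Finset Pt} {I : Pt → Pt → ℝ} {C_I : ℝ}

/-- [folklore] **THE MAJORANT OF THE (MIX-4) GHOST PIECE** (F′'s (hk): `MixLoopPowerCountingMassQuartic.abs_mix4_le_mass` BY NAME; the cut-off only helps): under the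
inner leg's SUP letter (I₀) `|I x u| ≤ C_I`, with the bond-letter pair mass `m_{c,e}(s,s′) = Σ_{u∈U s}Σ_{w∈W}|ker₂^{(u)}(s,c)(s′,e)(s+w)|`:
`|gmix4Piece … c e s s′| ≤ C_I·m_{c,e}(s,s′)`. -/
theorem kappa_gmix4Piece (hI : ∀ x u, |I x u| ≤ C_I) (Nw : ℕ) (c e : Fin 4) (s s' : Pt) :
    |gmix4Piece N p rad U W I Nw c e s s'| ≤ C_I * ∑ u ∈ U s, ∑ w ∈ W, |ker₂ (sclW N p) (sclFld N u) (sclBg N u rad) (s, c) (s', e) (s + w)| := by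
  have hmain := abs_mix4_le_mass (U := U) (W := W)
    (qdd := fun u b b' x => ker₂ (sclW N p) (sclFld N u) (sclBg N u rad) (b, c) (b', e) x) (I := I) hI s s'
  rw [gmix4Piece_apply]
  split_ifs
  · exact hmain
  · rw [abs_zero]
    exact le_trans (abs_nonneg _) hmain

/-- [folklore] **ENTRY BOUND** (F′'s `hGb`): with a DISPLAYED sup letter (Psup) of the pair mass `m_{c,e}(s,s′) ≤ Psup`, every entry is bounded by `C_I·Psup`. -/
theorem bounded_gmix4Piece (hI : ∀ x u, |I x u| ≤ C_I)
    {Psup : ℝ} (hPsup : ∀ (c e : Fin 4) (s s' : Pt), ∑ u ∈ U s, ∑ w ∈ W, |ker₂ (sclW N p) (sclFld N u) (sclBg N u rad) (s, c) (s', e) (s + w)| ≤ Psup)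
    (Nw : ℕ) (c e : Fin 4) :
    ∃ A, ∀ s s', |gmix4Piece N p rad U W I Nw c e s s'| ≤ A := by
  have hC : 0 ≤ C_I := (abs_nonneg _).trans (hI 0 0)
  exact ⟨C_I * Psup, fun s s' => (kappa_gmix4Piece hI Nw c e s s').trans (mul_le_mul_of_nonneg_left (hPsup c e s s') hC)⟩

end Shape

/-! ## §4 The ledger line, by name over `FineSplitJunctionMajorant.rem_of_majorant` -/

section Ledger

variable {N : ℕ} {p : σ → ℝ} {rad : σ → Pt → Pt → List (Pt × Fin 4)} {ℓ₀ R₀ : ℕ} {U : Pt → Finset Pt} {W : Finset Pt}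
  {I : Pt → Pt → ℝ} {C_I δ C_J C_J' : ℝ} {K : MKer (3 + 1) (Fib 3)} {a b : Fin 4}

/-- **THE LEDGER LINE OF THE (MIX-4) GHOST PIECE** [folklore] (the `hLgh` binder for this piece): `K` block-covariant with absolutely summable END columns and the
column letters (J) (anchor `0`) ∕ (J′) at rate `δ`; the bond family's letters (`p ≥ 0`, length `≤ ℓ₀`, radius `R₀N`, (radCov)); (Ucov); the inner leg's SUP letter
(I₀) and (Icov); the pair-mass sup letter (Psup) ⟹ for every finite coarse `S′`,
`Σ_{u∈S′}‖u‖∞²·|dressedEntryP (colH K N · 0 ·) (gmix4Piece N p rad U W I Nw) (N•(−u)) a b| ≤ 16·(3·C_J·C_J′·(1+16∕δ²)·(C_I·(1+4R₀²)·(2ℓ₀(ℓ₀Σp))·e^{δR₀∕2}(e^{δ∕2}(1+480e^{δ∕4}(4∕δ)⁴))))`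
(`rem_of_majorant` with `κ c e := C_I·m_{c,e}`, (Mκ) := `GhostMixQuarticTwoLeg.windowedPairMass_bond_le` at the anchor `0` BY NAME).  The window rate `δ` is the
COLUMNS' rate (the word itself is supported on one path — no radius hypothesis on `U`, `W`). -/
theorem ledger_gmix4Piece (hδ : 0 < δ) (hN : 1 ≤ N)
    (hKcov : ∀ t : Fin (3 + 1) → ℤ, shiftK (-((N : ℤ) • t)) K = K)
    (hcol : ∀ κ l : Fin 4, Summable fun x => |colOf K κ l x|)
    (hp : ∀ s, 0 ≤ p s) (hrad : ∀ s u x', (rad s u x').length ≤ ℓ₀)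
    (hradR : ∀ (s : σ) (u : Pt) (x : ↥(fineBlock N)) (ℓ : Pt × Fin 4), ℓ ∈ rad s u x.1 → supNorm (ℓ.1 - (N : ℤ) • u) ≤ R₀ * N)
    (hradCov : ∀ (s : σ) (u t x' : Pt), rad s (u + t) x' = (rad s u x').map (fun ℓ => (ℓ.1 + (N : ℤ) • t, ℓ.2)))
    (hUcov : ∀ b t : Pt, U (b + (N : ℤ) • t) = (U b).image (· + t))
    (hI : ∀ x u, |I x u| ≤ C_I) (hIcov : ∀ x u t : Pt, I (x + (N : ℤ) • t) (u + t) = I x u)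
    {Psup : ℝ} (hPsup : ∀ (c e : Fin 4) (s s' : Pt), ∑ u ∈ U s, ∑ w ∈ W, |ker₂ (sclW N p) (sclFld N u) (sclBg N u rad) (s, c) (s', e) (s + w)| ≤ Psup)
    (hJ : ∀ (c : Fin 4) (q : Pt), |colH K N a 0 c q| ≤ C_J * Real.exp (-(δ / N) * (supNorm (q - (N : ℤ) • (0 : Pt)) : ℝ)))
    (hJ' : ∀ (e : Fin 4) (S' : Finset Pt) (x : Pt), ∑ u ∈ S', (1 + ((supNorm (x - (N : ℤ) • u) : ℝ) / N) ^ 2) * |colH K N b u e x| ≤ C_J')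
    (Nw : ℕ) :
    ∀ S' : Finset Pt, ∑ u ∈ S', (supNorm u : ℝ) ^ 2 *
        |dressedEntryP (fun c a' => colH K N a' 0 c) (gmix4Piece N p rad U W I Nw) ((N : ℤ) • (-u)) a b|
      ≤ 16 * (3 * C_J * C_J' * (1 + 16 / δ ^ 2) *
          (C_I * ((1 + 4 * (R₀ : ℝ) ^ 2) * (((2 * ((ℓ₀ : ℕ) : ℝ)) * (((ℓ₀ : ℕ) : ℝ) * ∑ s, p s)) * Real.exp (δ * R₀ / 2) *
            (Real.exp (δ / 2) * (1 + 480 * Real.exp (δ / 4) * (4 / δ) ^ 4)))))) := by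
  have hC : 0 ≤ C_I := (abs_nonneg _).trans (hI 0 0)
  -- (Mκ) at the anchor `0`: the constant `C_I` pulled out of `windowedPairMass_bond_le`
  have hAκ : ∀ (c e : Fin 4) (A : Finset Pt),
      ∑ q ∈ A, ∑ x ∈ A, Real.exp (-(δ / (2 * N)) * (supNorm (q - (N : ℤ) • (0 : Pt)) : ℝ)) * (1 + ((supNorm (x - q) : ℝ) / N) ^ 2) *
          (C_I * ∑ u ∈ U q, ∑ w ∈ W, |ker₂ (sclW N p) (sclFld N u) (sclBg N u rad) (q, c) (x, e) (q + w)|)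
        ≤ C_I * ((1 + 4 * (R₀ : ℝ) ^ 2) * (((2 * ((ℓ₀ : ℕ) : ℝ)) * (((ℓ₀ : ℕ) : ℝ) * ∑ s, p s)) * Real.exp (δ * R₀ / 2) *
            (Real.exp (δ / 2) * (1 + 480 * Real.exp (δ / 4) * (4 / δ) ^ 4)))) := by
    intro c e A
    have hW := windowedPairMass_bond_le hδ hN hp hrad hradR U W A (0 : Pt) c e
    calc ∑ q ∈ A, ∑ x ∈ A, Real.exp (-(δ / (2 * N)) * (supNorm (q - (N : ℤ) • (0 : Pt)) : ℝ)) * (1 + ((supNorm (x - q) : ℝ) / N) ^ 2) *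
            (C_I * ∑ u ∈ U q, ∑ w ∈ W, |ker₂ (sclW N p) (sclFld N u) (sclBg N u rad) (q, c) (x, e) (q + w)|)
        = C_I * ∑ q ∈ A, ∑ x ∈ A, Real.exp (-(δ / (2 * N)) * (supNorm (q - (N : ℤ) • (0 : Pt)) : ℝ)) * (1 + ((supNorm (x - q) : ℝ) / N) ^ 2) *
            (∑ u ∈ U q, ∑ w ∈ W, |ker₂ (sclW N p) (sclFld N u) (sclBg N u rad) (q, c) (x, e) (q + w)|) := by
          rw [Finset.mul_sum]
          refine Finset.sum_congr rfl fun q _ => ?_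
          rw [Finset.mul_sum]
          exact Finset.sum_congr rfl fun x _ => by ring
      _ ≤ _ := mul_le_mul_of_nonneg_left hW hC
  exact rem_of_majorant (G := gmix4Piece N p rad U W I Nw)
    (κ := fun c e s s' => C_I * ∑ u ∈ U s, ∑ w ∈ W, |ker₂ (sclW N p) (sclFld N u) (sclBg N u rad) (s, c) (s', e) (s + w)|)
    hδ hN hKcov hcol (fun c e => isBlockPeriodic_gmix4Piece hradCov hUcov hIcov W Nw c e)
    (fun c e => bounded_gmix4Piece hI hPsup Nw c e) (fun c e s s' => kappa_gmix4Piece hI Nw c e s s') hAκ hJ hJ'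

end Ledger

end Summit.QuantumFields.BalabanUV.Beta.FP.GhostMixPieceQuartic

end
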